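import Summits.QuantumFields.YangMills.Theorems.BalabanUVNodesN22AtRecordOfPrintedSlots
import Summits.QuantumFields.YangMills.Theorems.BalabanUVNodesN22WindowedNE9OfStripSchemas

/-!
# NODE N22 (NE9) ∕ (D4) — VALUE LETTERS AT THE RECORD: the generic passages «any windowed (5.10) VALUE letter at a localizing reading ⟹ K3⁷ v5 §2b's `hdec` and the (D4) pin
# face», J36's value letter FROM OUTPUT-LEVEL DATA ONLY (a displayed term bound (1.18) on the complex space, or node00-def-W1's `TermBound118` by name) READ AT THE RECORD —
# «J36-at-record» —, and J35 v1.1's value letter FROM THE PER-STEP SCHEMAS read at the record («J35-v1.1-at-record»)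

Cell `pub-ymgap`, Track A (HUMAN RULING D-0062), WIDTH SEAT `dag-n22-w5` (g0′, harness re-seat of base w5) on node n22 = NE9, D-0154 (3a) second width wave;
`--kind proof --supports stmt-QuantumFields-20544 --as helper` (K3⁷ `SpineGivenEndpointR13SepCoPH`, skeleton v5 941dddb108cbaacf), COUNT-NEUTRAL; THEOREMS ONLY (0 `def`,
0 `sorry`, standard axioms).  dag-n22-c g13's word «J36's record edition = one application of (B)'s `kernelDecayOfRecord₁₃` road — w5∕w2's if wanted» (pub-ymgap INBOX
2026-08-28T08:06:45Z; CLAIM-3 ∕ INTENT-3 of this seat).  J36 = dag-n22-c g13's `…N22WindowedDecayOutputLevel` (p617033): the VALUE letter `WindowedDecay F (localizedSum F S emb) ρ bV W μ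
ν δ₁` from OUTPUT-level inputs only — NO activity-level slot, NO (2.38), NO Road-1 numerals; J35 v1.1 = its `…N22WindowedNE9OfStripSchemas` §3 (p618510): the same value letter with
`TermBound118` DISCHARGED per torus from the per-step schemas (node N10's `h226TOnOlder` + node N09's `EHoloAt` families + Lemma 3's socket numerals).  This file imports J35 v1.1
(which imports J36).  Nothing of J35 ∕ J36 ∕ (A) ∕ (B) ∕ W1-19b ∕ p595227 ∕ p591653 is re-declared; every step is plain application.

WHAT.
* §1 GENERIC VALUE-LETTER PASSAGES AT THE RECORD (value twins of `…N22AtRecordOfDichotomyLetter` §1; `𝔸` instance-FREE, reading algebra `MatA N`): ★ `kernelDecayOfRecord₁₃_of_valueLetterOfRecord`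
  (W1-19b `WindowedDecayOfRecord₁₃ F N θ μ ν δ` + `PolLimitsExistOfRecord₁₃ F N θ` + `κ′ ≤ δ` ⟹ v5 §2b's `hdec : KernelDecayOfRecord₁₃ F N θ μ ν κ′` — (A) §1b `windowedDecay_of_le` + W1-19b
  `…_iff` + dag-n22-w3's `kernelDecayOfRecord₁₃_of_windowed` (p595227), the three lines (B) §2 ∕ `…CouplingHoloSlots` ∕ `…PrintedSlots` inline, named once) · ★
  `kernelDecayOfRecord₁₃_of_windowedValueLetter` (ANY `WindowedDecay F (localizedSum F S emb) θ.ρ8 θ.bV (Window θ.γ) μ ν δ` at a localizing reading ⟹ `hdec`, via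
  `windowedDecayOfRecord₁₃_iff_of_localizes`) · ★ `readOutAt_rateCarriers_of_kernels_pin_of_valueLetterOfRecord` ∕ ★ `…_of_windowedValueLetter` (the (D4) pin face `ReadOutAt (datumOfRecord₁₃CoPH
  F N θ hP) (rateCarriersOfRecord₁₃CoPH 𝔯 F θ hP g₀ os k).u3` ∀ k under `hpin`, from either letter at `(μ, ν) = (0, 1)` with `ℓ.Signs`, `0 < ℓ.κ ≤ δ`, `β′₅.₁₀(4,1,ℓ.κ) ≤ ℓ.cr` —
  dag-n27-w1's `readOutAt_objectsOfRecord₁₃_coPH` = K3⁷ v5 §2b `readOutAt_rrOfRecord_of_pinned` at the selector's value; (5.10) NOT discharged).  Every producer of a value letter at a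
  localizing reading — (A), J32′, J36, J35 v1.1, future ones — reaches `hdec` and the (D4) pin face by ONE application.
* §2 J36 AT THE RECORD: ★★★ `kernelDecayOfRecord₁₃_of_outputBound` ∕ ★★★ `readOutAt_rateCarriers_of_kernels_pin_of_outputBound` (law + DISPLAYED output-level term bound `‖E^{(k+1)}(X;
  histPrefix g k; φ)‖ ≤ B·e^{−κ_E d_{k+1}(X)}` on `sp K k X`, [I] (1.18) on the complex space + complexified probe readings `Φ K k X` of the record's β-chart with the TERM holomorphic through
  them + p. 282 tails + `δ₀ > 0`, `2κ₀(64,8) ≤ κ ≤ κ_E` + (1.21) existence ⟹ `hdec` at any `κ′ ≤ δ₁ = ½min{δ₀, κ(4M)⁻¹}` ∕ the (D4) pin face ∀ k — J36 `windowedDecay_localizedSum_of_outputBound`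
  at `W := Window θ.γ` ∘ §1) · ★★★ `kernelDecayOfRecord₁₃_of_termBound118` ∕ ★★★ `readOutAt_rateCarriers_of_kernels_pin_of_termBound118` (the same with the bound LITERALLY node00-def-W1's
  printed-type predicate `W1.TermBound118 (S K) (Window θ.γ) (spj K) B κ_E`, readings' tables `spj K (k+1)` — J36 `windowedDecay_localizedSum_of_termBound118` ∘ §1).
* §3 J35 v1.1 AT THE RECORD (value): ★★★ `kernelDecayOfRecord₁₃_of_stripSchemas` ∕ ★★★ `readOutAt_rateCarriers_of_kernels_pin_of_stripSchemas` (`𝔸` a complete normed ℂ-algebra; space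
  tables of record `U^c_{k+1}(X, cs.α₀, cs.α₁)`; per torus: node N10's `h226TOnOlder` UNIVERSAL IN THE DOMAIN + node N09's `EHoloAt (sfTowerOfRecord (Sg K) (Rz K) M (S K) ⟨g, β K⟩ (logZ K))
  cs k` families with uniform `(E₀, r_E > 0)` + socket numerals `Lemma3Numerics c M (½L) …`, `8 ≤ c.L`, S25's clauses, renewal, `θ.γ ≤ cs.γ`, `κ ≤ cs.κ` + J34's term holomorphy through the
  readings + tails + `2κ₀(64,8) ≤ κ_w ≤ κ` + (1.21) — J35 v1.1 `windowedDecay_localizedSum_of_stripSchemas` at `W := Window θ.γ` ∘ §1).  With `…N22AtRecordOfStepSchemas` §2 (this seat,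
  p618341) BOTH v5 §2b letters `h9` ∕ `hdec` and the N22 ∕ (D4) pin faces are read AT THE RECORD from the per-step schemas.

HONEST FRAMING (binding).  Count-neutral COMPOSITION of landed theorems by name; NO estimate of Bałaban's is proved or asserted; every displayed input is a HYPOTHESIS with its
owner (printed (1.18) ∕ `TermBound118` at NODE A's towers: N10's Lemmas 1–3 ⟹ (2.41) ⟹ (1.18) — in the tree from the activity level by dag-n22-c's `termBound118_of_stripBound` ∕ J30
v1.1, NOT here; `h226TOnOlder`: N10 — the common complex domain is the cell's complexification «(or analytic)», NOT a printed display; `EHoloAt` families at `sfTowerOfRecord`: N09 —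
their existence at Bałaban's objects is N09's theorem, not claimed here; term holomorphy through the readings + readings + tails: NODE A ∕ N09; law: NODE A ∕ N10 ∕ def-W1; (1.21):
dag-n22-w3's road; the letter rows `β′₅.₁₀ ≤ ℓ.cr`: the (D4) desks); (5.10) of record is NOT discharged; nothing of the record is constructed or claimed to meet the hypotheses; N22 and (D4) are NOT discharged (typed 28∕28 · discharged
5∕27 UNCHANGED); K3⁷ OPEN and NOT claimed; NE9 is NOT IN PRINT for d = 4; no count claim (the chair's single count line is the only count); no summit statement is proved by this seat;
one finite 𝕋⁴ programme at fixed ε — R4 closes the CONDITIONAL rung `BalabanLadder.UV` only; NOTHING about the continuum limit, ℝ⁴, infinite volume, OS axioms, a mass gap or the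
Clay problem is proved or claimed by any of this.  References (TYPES only, no cite tags on the Summit side): [I] = Bałaban, CMP 109 (1987) (1.7) p. 261, (1.18) p. 263, (1.20)–(1.21)
p. 264, p. 282, (4.35)–(4.37) pp. 290–291, (5.10) p. 293; [II] = CMP 116 (1988) (2.3) p. 12, (2.13)–(2.26) pp. 14–17, Lemma 3 (2.38) p. 20, (2.39)–(2.41) p. 21.
-/

noncomputable section

open Filter Topology Metric Set
open scoped BigOperators

namespace YMDAG.N22.AtRecordOfPrintedSlots

open Literature.MathematicalPhysics.QuantumFieldTheory.Balaban1983to89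
open Literature.MathematicalPhysics.QuantumFieldTheory.Balaban1983to89.T4Continuum (T4Family ULoop)
open Literature.MathematicalPhysics.QuantumFieldTheory.Balaban1983to89.T4OutputRate (Window)
open Literature.MathematicalPhysics.QuantumFieldTheory.Balaban1983to89.Node00
open Literature.MathematicalPhysics.QuantumFieldTheory.Balaban1983to89.Node00.Sect2 (domSys domCount CPair spaceI domSites Setting Residual)
open Literature.MathematicalPhysics.QuantumFieldTheory.Balaban1983to89.Node00.LocalizedSum17 (localizedSum ReadingMaps Localizes17OfRecord₁₃)
open Literature.MathematicalPhysics.QuantumFieldTheory.Balaban1983to89.Node00.W1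
open Literature.MathematicalPhysics.QuantumFieldTheory.Balaban1983to89.Node00.U3OfKernels (histPrefix objectsOfRecord₁₃ KernelDecayOfRecord₁₃)
open Literature.MathematicalPhysics.QuantumFieldTheory.Balaban1983to89.Node00.U3KernelLetters (WindowedDecay WindowedDecayOfRecord₁₃ PolLimitsExistOfRecord₁₃
  windowedDecayOfRecord₁₃_iff polLimitsExistOfRecord₁₃_iff windowedDecayOfRecord₁₃_iff_of_localizes)
open Literature.MathematicalPhysics.QuantumFieldTheory.Balaban1983to89.B12Decay510 (delta1)
open Literature.MathematicalPhysics.QuantumFieldTheory.Balaban1983to89.B12Decay510Torus (distCT nearT)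
open Literature.MathematicalPhysics.QuantumFieldTheory.Balaban1983to89.B12TreeDecay (K₀ kappa₀)
open Literature.MathematicalPhysics.QuantumFieldTheory.Balaban1983to89.TreeLengthTorus (TPt TDom torusTreeLen)
open Literature.MathematicalPhysics.QuantumFieldTheory.Balaban1983to89.B13Lemma3TorusData (TBond)
open Literature.MathematicalPhysics.QuantumFieldTheory.Balaban1983to89.B13Lemma3TorusTerms (terms weight)
open Literature.MathematicalPhysics.QuantumFieldTheory.Balaban1983to89.B13Lemma3TorusSocket (Lemma3Numerics)
open Literature.MathematicalPhysics.QuantumFieldTheory.Balaban1983to89.B12BetaHolo (EHoloAt)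
open Literature.MathematicalPhysics.QuantumFieldTheory.Balaban1983to89.Step (SFConsts)
open Literature.MathematicalPhysics.QuantumFieldTheory.Balaban1983to89.B12Sec2to5 (betaPrime510)
open YMDAG.UVSplit (ReadOutAt u3OfRecord₁₃ RateReading₁₃CoPH rateCarriersOfRecord₁₃CoPH)
open YMDAG.N22.AtKernels (kernelDecayOfRecord₁₃_of_windowed)
open YMDAG.N22.WindowSoftTwoPoint (windowedDecay_of_le)
open YMDAG.N22.OutputLevel (windowedDecay_localizedSum_of_outputBound windowedDecay_localizedSum_of_termBound118 windowedDecay_localizedSum_of_stripSchemas)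
open Summit.QuantumFields.YangMills.BalabanUVNodes.N27ReadOutAtU3OfKernels (readOutAt_objectsOfRecord₁₃_coPH)

open scoped Matrix.Norms.L2Operator

variable (F : T4Family) (N : ℕ) [NeZero N]

/-! ## §1 Value-letter passages at the record: W1-19b's value letter ∕ any windowed (5.10) value letter at a localizing reading ⟹ K3⁷ v5 §2b's `hdec` and the (D4) pin face -/

/-- ★ **FROM W1-19b's VALUE LETTER OF RECORD TO K3⁷ v5 §2b's `hdec`.**  `WindowedDecayOfRecord₁₃ F N θ μ ν δ` + the (1.21) existence `PolLimitsExistOfRecord₁₃ F N θ` ⟹ the (5.10) clause of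
record `KernelDecayOfRecord₁₃ F N θ μ ν κ′` at any `κ′ ≤ δ` — (A) §1b `windowedDecay_of_le` + W1-19b's two `…_iff` faces + dag-n22-w3's `kernelDecayOfRecord₁₃_of_windowed` (p595227).  LOCATED. -/
theorem kernelDecayOfRecord₁₃_of_valueLetterOfRecord (θ : Stage13Params F N) (hlim : PolLimitsExistOfRecord₁₃ F N θ) {μ ν : Fin 4} {δ κ' : ℝ}
    (hd : WindowedDecayOfRecord₁₃ F N θ μ ν δ) (hκ' : κ' ≤ δ) :
    KernelDecayOfRecord₁₃ F N θ μ ν κ' := by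
  have hd' : WindowedDecayOfRecord₁₃ F N θ μ ν κ' := by
    letI := θ.instVβ₁; letI := θ.instVβ₂; letI := θ.instιβ
    exact windowedDecay_of_le F _ θ.ρ8 θ.bV hd hκ'
  exact kernelDecayOfRecord₁₃_of_windowed F N θ μ ν _ ((polLimitsExistOfRecord₁₃_iff F N θ).1 hlim) ((windowedDecayOfRecord₁₃_iff F N θ μ ν _).1 hd')

/-- ★ **FROM ANY VALUE LETTER AT A LOCALIZING READING TO `hdec`.**  Towers `S K : ClusterTower (F.P K) 𝔸 M` (ANY `𝔸`) and a reading `emb : ReadingMaps F (MatA N) 𝔸` with W1-20's law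
`Localizes17OfRecord₁₃ F N θ S emb`: `WindowedDecay F (localizedSum F S emb) θ.ρ8 θ.bV (Window θ.γ) μ ν δ` + `PolLimitsExistOfRecord₁₃ F N θ` + `κ′ ≤ δ` ⟹ `KernelDecayOfRecord₁₃ F N θ μ ν κ′` —
W1-19b `windowedDecayOfRecord₁₃_iff_of_localizes`, then `kernelDecayOfRecord₁₃_of_valueLetterOfRecord`.  LOCATED (hypothesis form); (D4) NOT discharged. -/
theorem kernelDecayOfRecord₁₃_of_windowedValueLetter (θ : Stage13Params F N) (hlim : PolLimitsExistOfRecord₁₃ F N θ)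
    {𝔸 : Type*} {M : ℕ} (S : (K : ℕ) → ClusterTower (F.P K) 𝔸 M) (emb : ReadingMaps F (MatA N) 𝔸) (hloc : Localizes17OfRecord₁₃ F N θ S emb)
    {μ ν : Fin 4} {δ κ' : ℝ}
    (h : letI := θ.instVβ₁; letI := θ.instVβ₂; letI := θ.instιβ
      WindowedDecay F (localizedSum F S emb) θ.ρ8 θ.bV (Window θ.γ) μ ν δ)
    (hκ' : κ' ≤ δ) :
    KernelDecayOfRecord₁₃ F N θ μ ν κ' :=
  kernelDecayOfRecord₁₃_of_valueLetterOfRecord F N θ hlim ((windowedDecayOfRecord₁₃_iff_of_localizes F N θ S emb hloc μ ν _).2 h) hκ'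

/-- ★ **THE (D4) PIN FACE FROM W1-19b's VALUE LETTER OF RECORD**, every run length `k`, at a Stage-13 rate reading whose node-U3 objects at the tuple ARE the kernel objects of record
(`hpin`), for a letter block with `ℓ.Signs`, `0 < ℓ.κ ≤ δ`, `β′₅.₁₀(4,1,ℓ.κ) ≤ ℓ.cr`: `kernelDecayOfRecord₁₃_of_valueLetterOfRecord` at `(μ, ν) = (0, 1)`, `κ′ := ℓ.κ` ∘ dag-n27-w1's
`readOutAt_objectsOfRecord₁₃_coPH` (= v5 §2b `readOutAt_rrOfRecord_of_pinned` at the selector's value; (5.10) REDUCED there, NOT discharged).  LOCATED (hypothesis form). -/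
theorem readOutAt_rateCarriers_of_kernels_pin_of_valueLetterOfRecord (𝔯 : RateReading₁₃CoPH N) (θ : Stage13HParams F N) (hP : θ.Provisos₁₃CoPH F N)
    (g₀ : ℕ → ℝ) (os : List (ULoop F)) (ℓ : U3Letters₁₁) (hs : ℓ.Signs) (hℓ₀ : 0 < ℓ.κ) (hcr : betaPrime510 4 1 ℓ.κ ≤ ℓ.cr)
    (hpin : (𝔯.lit F θ hP g₀ os).u3 = objectsOfRecord₁₃ F N θ.toStage13Params ℓ)
    (hlim : PolLimitsExistOfRecord₁₃ F N θ.toStage13Params) {δ : ℝ} (hd : WindowedDecayOfRecord₁₃ F N θ.toStage13Params 0 1 δ) (hℓκ : ℓ.κ ≤ δ) (k : ℕ) :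
    ReadOutAt (datumOfRecord₁₃CoPH F N θ hP) (rateCarriersOfRecord₁₃CoPH 𝔯 F θ hP g₀ os k).u3 := by
  show ReadOutAt (datumOfRecord₁₃CoPH F N θ hP) (u3OfRecord₁₃ θ.toStage13Params (𝔯.lit F θ hP g₀ os).u3 k)
  rw [hpin]
  exact readOutAt_objectsOfRecord₁₃_coPH θ hP ℓ hs hℓ₀ hcr k
    (kernelDecayOfRecord₁₃_of_valueLetterOfRecord F N θ.toStage13Params hlim hd hℓκ)

/-- ★ **THE (D4) PIN FACE FROM ANY VALUE LETTER AT A LOCALIZING READING**, every run length `k`, under `hpin` — `kernelDecayOfRecord₁₃_of_windowedValueLetter` at `(μ, ν) = (0, 1)`,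
`κ′ := ℓ.κ`, fed to dag-n27-w1's `readOutAt_objectsOfRecord₁₃_coPH`.  LOCATED (hypothesis form); (D4) NOT discharged. -/
theorem readOutAt_rateCarriers_of_kernels_pin_of_windowedValueLetter (𝔯 : RateReading₁₃CoPH N) (θ : Stage13HParams F N) (hP : θ.Provisos₁₃CoPH F N)
    (g₀ : ℕ → ℝ) (os : List (ULoop F)) (ℓ : U3Letters₁₁) (hs : ℓ.Signs) (hℓ₀ : 0 < ℓ.κ) (hcr : betaPrime510 4 1 ℓ.κ ≤ ℓ.cr)
    (hpin : (𝔯.lit F θ hP g₀ os).u3 = objectsOfRecord₁₃ F N θ.toStage13Params ℓ)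
    (hlim : PolLimitsExistOfRecord₁₃ F N θ.toStage13Params)
    {𝔸 : Type*} {M : ℕ} (S : (K : ℕ) → ClusterTower (F.P K) 𝔸 M) (emb : ReadingMaps F (MatA N) 𝔸) (hloc : Localizes17OfRecord₁₃ F N θ.toStage13Params S emb)
    {δ : ℝ}
    (h : letI := θ.instVβ₁; letI := θ.instVβ₂; letI := θ.instιβ
      WindowedDecay F (localizedSum F S emb) θ.ρ8 θ.bV (Window θ.γ) 0 1 δ)
    (hℓκ : ℓ.κ ≤ δ) (k : ℕ) :
    ReadOutAt (datumOfRecord₁₃CoPH F N θ hP) (rateCarriersOfRecord₁₃CoPH 𝔯 F θ hP g₀ os k).u3 :=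
  readOutAt_rateCarriers_of_kernels_pin_of_valueLetterOfRecord F N 𝔯 θ hP g₀ os ℓ hs hℓ₀ hcr hpin hlim
    ((windowedDecayOfRecord₁₃_iff_of_localizes F N θ.toStage13Params S emb hloc 0 1 _).2 h) hℓκ k

/-! ## §2 J36's value letter READ AT THE RECORD: printed (1.18) on the complex space (displayed, or def-W1's `TermBound118` by name) + term holomorphy through the readings + tails -/

open Classical in
/-- ★★★ **K3⁷ v5 §2b's `hdec` FROM AN OUTPUT-LEVEL TERM BOUND** (J36 at the record).  Towers `S K : ClusterTower (F.P K) 𝔸 M` (`M = L^{m′}`; `𝔸` instance-FREE) read through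
`emb : ReadingMaps F (MatA N) 𝔸` with W1-20's law; per `(g ∈ ]0,θ.γ]^ℕ, K, k, X, φ ∈ sp K k X)` the DISPLAYED term bound `‖E^{(k+1)}(X; histPrefix g k; φ)‖ ≤ B·e^{−κ_E d_{k+1}(X)}` ([I] (1.18)
on the complex space; `0 ≤ B`, `κ ≤ κ_E`); complexified probe readings `Φ K k X` of the record's β-chart (open `U ⊇ ball 0 r`, chart clause, ball ↦ `sp K k X`) with the TERM holomorphic
through them; site weights with tails, `δ₀ > 0`, `2κ₀(64,8) ≤ κ`; `PolLimitsExistOfRecord₁₃ F N θ` ⟹ `KernelDecayOfRecord₁₃ F N θ μ ν κ′` at any `κ′ ≤ δ₁(δ₀, κ)` — J36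
`windowedDecay_localizedSum_of_outputBound` at `W := Window θ.γ` ∘ §1.  NO activity-level hypothesis.  LOCATED (hypothesis form); (D4) NOT discharged. -/
theorem kernelDecayOfRecord₁₃_of_outputBound (θ : Stage13Params F N) (hlim : PolLimitsExistOfRecord₁₃ F N θ) {𝔸 : Type*} (m' : ℕ) (M : ℕ) [NeZero M] (hM : M = F.L ^ m')
    (S : (K : ℕ) → ClusterTower (F.P K) 𝔸 M) (emb : ReadingMaps F (MatA N) 𝔸) (hloc : Localizes17OfRecord₁₃ F N θ S emb)
    (sp : (K k : ℕ) → (domSys (F.P K) M (k + 1)).Dom → Set (CPair (F.P K) 𝔸))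
    {κ κE δ₀ B₃ r B κ' : ℝ} (hκ₀ : kappa₀ (4 * 2 ^ 4) (2 * 4) ≤ κ / 2) (hδ₀ : 0 < δ₀) (hB₃ : 0 ≤ B₃) (hr : 0 < r) (hB : 0 ≤ B) (hκE : κ ≤ κE)
    (hbd : ∀ g ∈ Window θ.γ, ∀ (K k : ℕ) (X : (domSys (F.P K) M (k + 1)).Dom), ∀ φ ∈ sp K k X, ‖((S K) k).E (histPrefix g k) φ X‖ ≤ B * Real.exp (-(κE * (domSys (F.P K) M (k + 1)).dj X)))
    (Ec : ℕ → ℕ → Type*) [∀ K k, NormedAddCommGroup (Ec K k)] [∀ K k, NormedSpace ℂ (Ec K k)]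
    (ι : letI := θ.instVβ₁; letI := θ.instVβ₂
      (K k : ℕ) → (domSys (F.P K) M (k + 1)).Dom → ((Fin (F.P K).d → Site (F.P K) (k + 1) → θ.Vβ) →L[ℝ] Ec K k))
    (Φ : (K k : ℕ) → (domSys (F.P K) M (k + 1)).Dom → Ec K k → CPair (F.P K) 𝔸)
    (U : (K k : ℕ) → (domSys (F.P K) M (k + 1)).Dom → Set (Ec K k)) (hU : ∀ K k X, IsOpen (U K k X)) (hrU : ∀ K k X, ball (0 : Ec K k) r ⊆ U K k X)
    (hEhol : ∀ g ∈ Window θ.γ, ∀ (K k : ℕ) (X : (domSys (F.P K) M (k + 1)).Dom), DifferentiableOn ℂ (fun z => ((S K) k).E (histPrefix g k) (Φ K k X z) X) (U K k X))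
    (hΦemb : letI := θ.instVβ₁; letI := θ.instVβ₂
      ∀ (K k : ℕ) (X : (domSys (F.P K) M (k + 1)).Dom) (Bp : Fin (F.P K).d → Site (F.P K) (k + 1) → θ.Vβ),
        Φ K k X (ι K k X Bp) = emb K k (fun l t => NormedSpace.exp (θ.ρ8 (Bp l t))))
    (hΦsp : ∀ (K k : ℕ) (X : (domSys (F.P K) M (k + 1)).Dom), ∀ z ∈ ball (0 : Ec K k) r, Φ K k X z ∈ sp K k X)
    (w : (K k : ℕ) → (domSys (F.P K) M (k + 1)).Dom → Site (F.P K) (k + 1) → ℝ) (hw₀ : ∀ K k X t, 0 ≤ w K k X t)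
    (hw : letI := θ.instVβ₁; letI := θ.instVβ₂; letI := θ.instιβ
      ∀ (K k : ℕ) (X : (domSys (F.P K) M (k + 1)).Dom) (l : Fin (F.P K).d) (t : Site (F.P K) (k + 1)) (c : θ.ιβ),
        ‖ι K k X (Pi.single l (Pi.single t (θ.bV c)))‖ ≤ w K k X t)
    (htail : ∀ (K k : ℕ) (X : (domSys (F.P K) M (k + 1)).Dom) (t : Site (F.P K) (k + 1)),
      let e : Site (F.P K) (k + 1) → TPt 4 (domCount (F.P K) M (k + 1) * M) := fun x i => (ZMod.cast (x i) : ZMod (domCount (F.P K) M (k + 1) * M))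
      w K k X t ≤ B₃ * Real.exp (-δ₀ * distCT (domCount (F.P K) M (k + 1)) M (e t) (nearT (M := M) (e t) X)))
    (hκ' : κ' ≤ delta1 δ₀ κ ((M : ℝ) * 4)) (μ ν : Fin 4) :
    KernelDecayOfRecord₁₃ F N θ μ ν κ' := by
  letI := θ.instVβ₁; letI := θ.instVβ₂; letI := θ.instιβ
  exact kernelDecayOfRecord₁₃_of_windowedValueLetter F N θ hlim S emb hloc
    (windowedDecay_localizedSum_of_outputBound F m' M hM S emb θ.ρ8 θ.bV (Window θ.γ) sp hκ₀ hδ₀ hB₃ hr hB hκE hbd Ec ι Φ U hU hrU hEhol hΦemb hΦsp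
      w hw₀ hw htail μ ν)
    hκ'

open Classical in
/-- ★★★ **THE (D4) PIN FACE FROM AN OUTPUT-LEVEL TERM BOUND**, every run length `k`, under `hpin`, for a letter block with `ℓ.Signs`, `0 < ℓ.κ ≤ δ₁`, `β′₅.₁₀(4,1,ℓ.κ) ≤ ℓ.cr`:
`kernelDecayOfRecord₁₃_of_outputBound` at `(μ, ν) = (0, 1)`, `κ′ := ℓ.κ` ∘ dag-n27-w1's `readOutAt_objectsOfRecord₁₃_coPH` — «W1-20's law + printed (1.18) on the complex space tables + term
holomorphy through the complexified readings + p. 282 tails + (1.21) existence ⇒ the (D4) pin face at the pinned bundle, every run length».  LOCATED (hypothesis form); (D4) NOT discharged. -/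
theorem readOutAt_rateCarriers_of_kernels_pin_of_outputBound (𝔯 : RateReading₁₃CoPH N) (θ : Stage13HParams F N) (hP : θ.Provisos₁₃CoPH F N)
    (g₀ : ℕ → ℝ) (os : List (ULoop F)) (ℓ : U3Letters₁₁) (hs : ℓ.Signs) (hℓ₀ : 0 < ℓ.κ) (hcr : betaPrime510 4 1 ℓ.κ ≤ ℓ.cr)
    (hpin : (𝔯.lit F θ hP g₀ os).u3 = objectsOfRecord₁₃ F N θ.toStage13Params ℓ)
    (hlim : PolLimitsExistOfRecord₁₃ F N θ.toStage13Params) {𝔸 : Type*} (m' : ℕ) (M : ℕ) [NeZero M] (hM : M = F.L ^ m')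
    (S : (K : ℕ) → ClusterTower (F.P K) 𝔸 M) (emb : ReadingMaps F (MatA N) 𝔸) (hloc : Localizes17OfRecord₁₃ F N θ.toStage13Params S emb)
    (sp : (K k : ℕ) → (domSys (F.P K) M (k + 1)).Dom → Set (CPair (F.P K) 𝔸))
    {κ κE δ₀ B₃ r B : ℝ} (hκ₀ : kappa₀ (4 * 2 ^ 4) (2 * 4) ≤ κ / 2) (hδ₀ : 0 < δ₀) (hB₃ : 0 ≤ B₃) (hr : 0 < r) (hB : 0 ≤ B) (hκE : κ ≤ κE)
    (hbd : ∀ g ∈ Window θ.γ, ∀ (K k : ℕ) (X : (domSys (F.P K) M (k + 1)).Dom), ∀ φ ∈ sp K k X, ‖((S K) k).E (histPrefix g k) φ X‖ ≤ B * Real.exp (-(κE * (domSys (F.P K) M (k + 1)).dj X)))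
    (Ec : ℕ → ℕ → Type*) [∀ K k, NormedAddCommGroup (Ec K k)] [∀ K k, NormedSpace ℂ (Ec K k)]
    (ι : letI := θ.instVβ₁; letI := θ.instVβ₂
      (K k : ℕ) → (domSys (F.P K) M (k + 1)).Dom → ((Fin (F.P K).d → Site (F.P K) (k + 1) → θ.Vβ) →L[ℝ] Ec K k))
    (Φ : (K k : ℕ) → (domSys (F.P K) M (k + 1)).Dom → Ec K k → CPair (F.P K) 𝔸)
    (U : (K k : ℕ) → (domSys (F.P K) M (k + 1)).Dom → Set (Ec K k)) (hU : ∀ K k X, IsOpen (U K k X)) (hrU : ∀ K k X, ball (0 : Ec K k) r ⊆ U K k X)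
    (hEhol : ∀ g ∈ Window θ.γ, ∀ (K k : ℕ) (X : (domSys (F.P K) M (k + 1)).Dom), DifferentiableOn ℂ (fun z => ((S K) k).E (histPrefix g k) (Φ K k X z) X) (U K k X))
    (hΦemb : letI := θ.instVβ₁; letI := θ.instVβ₂
      ∀ (K k : ℕ) (X : (domSys (F.P K) M (k + 1)).Dom) (Bp : Fin (F.P K).d → Site (F.P K) (k + 1) → θ.Vβ),
        Φ K k X (ι K k X Bp) = emb K k (fun l t => NormedSpace.exp (θ.ρ8 (Bp l t))))
    (hΦsp : ∀ (K k : ℕ) (X : (domSys (F.P K) M (k + 1)).Dom), ∀ z ∈ ball (0 : Ec K k) r, Φ K k X z ∈ sp K k X)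
    (w : (K k : ℕ) → (domSys (F.P K) M (k + 1)).Dom → Site (F.P K) (k + 1) → ℝ) (hw₀ : ∀ K k X t, 0 ≤ w K k X t)
    (hw : letI := θ.instVβ₁; letI := θ.instVβ₂; letI := θ.instιβ
      ∀ (K k : ℕ) (X : (domSys (F.P K) M (k + 1)).Dom) (l : Fin (F.P K).d) (t : Site (F.P K) (k + 1)) (c : θ.ιβ),
        ‖ι K k X (Pi.single l (Pi.single t (θ.bV c)))‖ ≤ w K k X t)
    (htail : ∀ (K k : ℕ) (X : (domSys (F.P K) M (k + 1)).Dom) (t : Site (F.P K) (k + 1)),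
      let e : Site (F.P K) (k + 1) → TPt 4 (domCount (F.P K) M (k + 1) * M) := fun x i => (ZMod.cast (x i) : ZMod (domCount (F.P K) M (k + 1) * M))
      w K k X t ≤ B₃ * Real.exp (-δ₀ * distCT (domCount (F.P K) M (k + 1)) M (e t) (nearT (M := M) (e t) X)))
    (hℓκ : ℓ.κ ≤ delta1 δ₀ κ ((M : ℝ) * 4)) (k : ℕ) :
    ReadOutAt (datumOfRecord₁₃CoPH F N θ hP) (rateCarriersOfRecord₁₃CoPH 𝔯 F θ hP g₀ os k).u3 := by
  show ReadOutAt (datumOfRecord₁₃CoPH F N θ hP) (u3OfRecord₁₃ θ.toStage13Params (𝔯.lit F θ hP g₀ os).u3 k)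
  rw [hpin]
  exact readOutAt_objectsOfRecord₁₃_coPH θ hP ℓ hs hℓ₀ hcr k
    (kernelDecayOfRecord₁₃_of_outputBound F N θ.toStage13Params hlim m' M hM S emb hloc sp hκ₀ hδ₀ hB₃ hr hB hκE hbd Ec ι Φ U hU hrU hEhol hΦemb hΦsp
      w hw₀ hw htail hℓκ 0 1)

open Classical in
/-- ★★★ **K3⁷ v5 §2b's `hdec` FROM node00-def-W1's PRINTED-TYPE PREDICATE `TermBound118`** (J36 at the record): as `kernelDecayOfRecord₁₃_of_outputBound` with the term bound LITERALLY
`W1.TermBound118 (S K) (Window θ.γ) (spj K) B κ_E` at every torus ([I] (1.18) for every window history, level `j` and configuration of `spj K j`; readings' tables `spj K (k+1)`) — J36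
`windowedDecay_localizedSum_of_termBound118` at `W := Window θ.γ` ∘ §1.  LOCATED (hypothesis form); (D4) NOT discharged. -/
theorem kernelDecayOfRecord₁₃_of_termBound118 (θ : Stage13Params F N) (hlim : PolLimitsExistOfRecord₁₃ F N θ) {𝔸 : Type*} (m' : ℕ) (M : ℕ) [NeZero M] (hM : M = F.L ^ m')
    (S : (K : ℕ) → ClusterTower (F.P K) 𝔸 M) (emb : ReadingMaps F (MatA N) 𝔸) (hloc : Localizes17OfRecord₁₃ F N θ S emb)
    (spj : (K j : ℕ) → (domSys (F.P K) M j).Dom → Set (CPair (F.P K) 𝔸))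
    {κ κE δ₀ B₃ r B κ' : ℝ} (hκ₀ : kappa₀ (4 * 2 ^ 4) (2 * 4) ≤ κ / 2) (hδ₀ : 0 < δ₀) (hB₃ : 0 ≤ B₃) (hr : 0 < r) (hB : 0 ≤ B) (hκE : κ ≤ κE)
    (hT : ∀ K : ℕ, TermBound118 (S K) (Window θ.γ) (spj K) B κE)
    (Ec : ℕ → ℕ → Type*) [∀ K k, NormedAddCommGroup (Ec K k)] [∀ K k, NormedSpace ℂ (Ec K k)]
    (ι : letI := θ.instVβ₁; letI := θ.instVβ₂
      (K k : ℕ) → (domSys (F.P K) M (k + 1)).Dom → ((Fin (F.P K).d → Site (F.P K) (k + 1) → θ.Vβ) →L[ℝ] Ec K k))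
    (Φ : (K k : ℕ) → (domSys (F.P K) M (k + 1)).Dom → Ec K k → CPair (F.P K) 𝔸)
    (U : (K k : ℕ) → (domSys (F.P K) M (k + 1)).Dom → Set (Ec K k)) (hU : ∀ K k X, IsOpen (U K k X)) (hrU : ∀ K k X, ball (0 : Ec K k) r ⊆ U K k X)
    (hEhol : ∀ g ∈ Window θ.γ, ∀ (K k : ℕ) (X : (domSys (F.P K) M (k + 1)).Dom), DifferentiableOn ℂ (fun z => ((S K) k).E (histPrefix g k) (Φ K k X z) X) (U K k X))
    (hΦemb : letI := θ.instVβ₁; letI := θ.instVβ₂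
      ∀ (K k : ℕ) (X : (domSys (F.P K) M (k + 1)).Dom) (Bp : Fin (F.P K).d → Site (F.P K) (k + 1) → θ.Vβ),
        Φ K k X (ι K k X Bp) = emb K k (fun l t => NormedSpace.exp (θ.ρ8 (Bp l t))))
    (hΦsp : ∀ (K k : ℕ) (X : (domSys (F.P K) M (k + 1)).Dom), ∀ z ∈ ball (0 : Ec K k) r, Φ K k X z ∈ spj K (k + 1) X)
    (w : (K k : ℕ) → (domSys (F.P K) M (k + 1)).Dom → Site (F.P K) (k + 1) → ℝ) (hw₀ : ∀ K k X t, 0 ≤ w K k X t)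
    (hw : letI := θ.instVβ₁; letI := θ.instVβ₂; letI := θ.instιβ
      ∀ (K k : ℕ) (X : (domSys (F.P K) M (k + 1)).Dom) (l : Fin (F.P K).d) (t : Site (F.P K) (k + 1)) (c : θ.ιβ),
        ‖ι K k X (Pi.single l (Pi.single t (θ.bV c)))‖ ≤ w K k X t)
    (htail : ∀ (K k : ℕ) (X : (domSys (F.P K) M (k + 1)).Dom) (t : Site (F.P K) (k + 1)),
      let e : Site (F.P K) (k + 1) → TPt 4 (domCount (F.P K) M (k + 1) * M) := fun x i => (ZMod.cast (x i) : ZMod (domCount (F.P K) M (k + 1) * M))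
      w K k X t ≤ B₃ * Real.exp (-δ₀ * distCT (domCount (F.P K) M (k + 1)) M (e t) (nearT (M := M) (e t) X)))
    (hκ' : κ' ≤ delta1 δ₀ κ ((M : ℝ) * 4)) (μ ν : Fin 4) :
    KernelDecayOfRecord₁₃ F N θ μ ν κ' := by
  letI := θ.instVβ₁; letI := θ.instVβ₂; letI := θ.instιβ
  exact kernelDecayOfRecord₁₃_of_windowedValueLetter F N θ hlim S emb hloc
    (windowedDecay_localizedSum_of_termBound118 F m' M hM S emb θ.ρ8 θ.bV (Window θ.γ) spj hκ₀ hδ₀ hB₃ hr hB hκE hT Ec ι Φ U hU hrU hEhol hΦemb hΦsp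
      w hw₀ hw htail μ ν)
    hκ'

open Classical in
/-- ★★★ **THE (D4) PIN FACE FROM `TermBound118`**, every run length `k`, under `hpin`, for a letter block with `ℓ.Signs`, `0 < ℓ.κ ≤ δ₁`, `β′₅.₁₀(4,1,ℓ.κ) ≤ ℓ.cr`:
`kernelDecayOfRecord₁₃_of_termBound118` at `(μ, ν) = (0, 1)`, `κ′ := ℓ.κ`, fed to dag-n27-w1's `readOutAt_objectsOfRecord₁₃_coPH`.  LOCATED (hypothesis form); (D4) NOT discharged. -/
theorem readOutAt_rateCarriers_of_kernels_pin_of_termBound118 (𝔯 : RateReading₁₃CoPH N) (θ : Stage13HParams F N) (hP : θ.Provisos₁₃CoPH F N)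
    (g₀ : ℕ → ℝ) (os : List (ULoop F)) (ℓ : U3Letters₁₁) (hs : ℓ.Signs) (hℓ₀ : 0 < ℓ.κ) (hcr : betaPrime510 4 1 ℓ.κ ≤ ℓ.cr)
    (hpin : (𝔯.lit F θ hP g₀ os).u3 = objectsOfRecord₁₃ F N θ.toStage13Params ℓ)
    (hlim : PolLimitsExistOfRecord₁₃ F N θ.toStage13Params) {𝔸 : Type*} (m' : ℕ) (M : ℕ) [NeZero M] (hM : M = F.L ^ m')
    (S : (K : ℕ) → ClusterTower (F.P K) 𝔸 M) (emb : ReadingMaps F (MatA N) 𝔸) (hloc : Localizes17OfRecord₁₃ F N θ.toStage13Params S emb)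
    (spj : (K j : ℕ) → (domSys (F.P K) M j).Dom → Set (CPair (F.P K) 𝔸))
    {κ κE δ₀ B₃ r B : ℝ} (hκ₀ : kappa₀ (4 * 2 ^ 4) (2 * 4) ≤ κ / 2) (hδ₀ : 0 < δ₀) (hB₃ : 0 ≤ B₃) (hr : 0 < r) (hB : 0 ≤ B) (hκE : κ ≤ κE)
    (hT : ∀ K : ℕ, TermBound118 (S K) (Window θ.γ) (spj K) B κE)
    (Ec : ℕ → ℕ → Type*) [∀ K k, NormedAddCommGroup (Ec K k)] [∀ K k, NormedSpace ℂ (Ec K k)]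
    (ι : letI := θ.instVβ₁; letI := θ.instVβ₂
      (K k : ℕ) → (domSys (F.P K) M (k + 1)).Dom → ((Fin (F.P K).d → Site (F.P K) (k + 1) → θ.Vβ) →L[ℝ] Ec K k))
    (Φ : (K k : ℕ) → (domSys (F.P K) M (k + 1)).Dom → Ec K k → CPair (F.P K) 𝔸)
    (U : (K k : ℕ) → (domSys (F.P K) M (k + 1)).Dom → Set (Ec K k)) (hU : ∀ K k X, IsOpen (U K k X)) (hrU : ∀ K k X, ball (0 : Ec K k) r ⊆ U K k X)
    (hEhol : ∀ g ∈ Window θ.γ, ∀ (K k : ℕ) (X : (domSys (F.P K) M (k + 1)).Dom), DifferentiableOn ℂ (fun z => ((S K) k).E (histPrefix g k) (Φ K k X z) X) (U K k X))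
    (hΦemb : letI := θ.instVβ₁; letI := θ.instVβ₂
      ∀ (K k : ℕ) (X : (domSys (F.P K) M (k + 1)).Dom) (Bp : Fin (F.P K).d → Site (F.P K) (k + 1) → θ.Vβ),
        Φ K k X (ι K k X Bp) = emb K k (fun l t => NormedSpace.exp (θ.ρ8 (Bp l t))))
    (hΦsp : ∀ (K k : ℕ) (X : (domSys (F.P K) M (k + 1)).Dom), ∀ z ∈ ball (0 : Ec K k) r, Φ K k X z ∈ spj K (k + 1) X)
    (w : (K k : ℕ) → (domSys (F.P K) M (k + 1)).Dom → Site (F.P K) (k + 1) → ℝ) (hw₀ : ∀ K k X t, 0 ≤ w K k X t)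
    (hw : letI := θ.instVβ₁; letI := θ.instVβ₂; letI := θ.instιβ
      ∀ (K k : ℕ) (X : (domSys (F.P K) M (k + 1)).Dom) (l : Fin (F.P K).d) (t : Site (F.P K) (k + 1)) (c : θ.ιβ),
        ‖ι K k X (Pi.single l (Pi.single t (θ.bV c)))‖ ≤ w K k X t)
    (htail : ∀ (K k : ℕ) (X : (domSys (F.P K) M (k + 1)).Dom) (t : Site (F.P K) (k + 1)),
      let e : Site (F.P K) (k + 1) → TPt 4 (domCount (F.P K) M (k + 1) * M) := fun x i => (ZMod.cast (x i) : ZMod (domCount (F.P K) M (k + 1) * M))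
      w K k X t ≤ B₃ * Real.exp (-δ₀ * distCT (domCount (F.P K) M (k + 1)) M (e t) (nearT (M := M) (e t) X)))
    (hℓκ : ℓ.κ ≤ delta1 δ₀ κ ((M : ℝ) * 4)) (k : ℕ) :
    ReadOutAt (datumOfRecord₁₃CoPH F N θ hP) (rateCarriersOfRecord₁₃CoPH 𝔯 F θ hP g₀ os k).u3 := by
  show ReadOutAt (datumOfRecord₁₃CoPH F N θ hP) (u3OfRecord₁₃ θ.toStage13Params (𝔯.lit F θ hP g₀ os).u3 k)
  rw [hpin]
  exact readOutAt_objectsOfRecord₁₃_coPH θ hP ℓ hs hℓ₀ hcr k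
    (kernelDecayOfRecord₁₃_of_termBound118 F N θ.toStage13Params hlim m' M hM S emb hloc spj hκ₀ hδ₀ hB₃ hr hB hκE hT Ec ι Φ U hU hrU hEhol hΦemb hΦsp
      w hw₀ hw htail hℓκ 0 1)

/-! ## §3 J35 v1.1's value letter READ AT THE RECORD: node N10's older-coupling schema + node N09's `EHoloAt` families + Lemma 3's socket numerals -/

open Classical in
/-- ★★★ **K3⁷ v5 §2b's `hdec` FROM THE PER-STEP SCHEMAS** (J35 v1.1 at the record).  Towers `S K : ClusterTower (F.P K) 𝔸 M` (`M = L_F^{m′}`; `𝔸` a complete normed ℂ-algebra) read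
through `emb : ReadingMaps F (MatA N) 𝔸` with W1-20's law, at the space tables of record `U^c_{k+1}(X, cs.α₀, cs.α₁)`; per torus: node N10's `h226TOnOlder` UNIVERSAL IN THE DOMAIN, node
N09's `EHoloAt (sfTowerOfRecord (Sg K) (Rz K) M (S K) ⟨g, β K⟩ (logZ K)) cs k` per window history and step with uniform `(E₀, r_E > 0)`, the socket numerals `Lemma3Numerics c M (½L) …`,
`8 ≤ c.L`, S25's clauses at `A := C₃ε₁`, the renewal, `θ.γ ≤ cs.γ`, `κ ≤ cs.κ`; J34's term holomorphy through the complexified readings (chart clause, ball ↦ `U^c_{k+1}(X)`); tails,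
`δ₀ > 0`, `2κ₀(64,8) ≤ κ_w ≤ κ`; `PolLimitsExistOfRecord₁₃ F N θ` ⟹ `KernelDecayOfRecord₁₃ F N θ μ ν κ′` at any `κ′ ≤ δ₁(δ₀, κ_w)` — J35 v1.1 `windowedDecay_localizedSum_of_stripSchemas`
at `W := Window θ.γ` ∘ §1.  LOCATED (hypothesis form); (D4) NOT discharged. -/
theorem kernelDecayOfRecord₁₃_of_stripSchemas (θ : Stage13Params F N) (hlim : PolLimitsExistOfRecord₁₃ F N θ)
    {𝔸 : Type*} [NormedRing 𝔸] [NormedAlgebra ℂ 𝔸] [CompleteSpace 𝔸] {G : Type*} [GaugeGroup G] (m' : ℕ) (M : ℕ) [NeZero M] (hM : M = F.L ^ m')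
    (S : (K : ℕ) → ClusterTower (F.P K) 𝔸 M) (emb : ReadingMaps F (MatA N) 𝔸) (hloc : Localizes17OfRecord₁₃ F N θ S emb)
    (Sg : (K : ℕ) → Setting 𝔸 G) (Rz : (K : ℕ) → Residual (F.P K) 𝔸) (logZ : (K : ℕ) → ℕ → GaugeField (F.P K) 0 G → ℝ) (β : ℕ → ℕ → ℝ → ℝ)
    (c : B13.Consts) {L : ℕ} [NeZero L] (hL : 8 ≤ c.L) (hLc : c.L = L) {a a₂ a₂' a₅ Aabs : ℝ} (hN : Lemma3Numerics c M ((c.L : ℝ) / 2) a a₂ a₂' a₅ Aabs) (cs : SFConsts) (hγ : θ.γ ≤ cs.γ)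
    {rE E₀ κ r₁ κw δ₀ B₃ r κ' : ℝ} (hrE : 0 < rE) (hA0 : 0 ≤ c.C3act * c.ε₁) (hr₁ : 0 ≤ r₁) (hκ : κ ≤ r₁)
    (hrate : r₁ + 2 * (64 * Real.log 162) + 2 ≤ (1 - 8 * c.δ) * ((c.L : ℝ) / 2) * c.κ)
    (hsmall : c.C3act * c.ε₁ * Real.exp (5 * r₁ + 1) * K₀ 64 8 * 9 * 64 ≤ 1)
    (hrenew : Real.exp 1 * 9 * 64 * K₀ 64 8 ^ 2 * (c.C3act * c.ε₁) ≤ E₀) (hκc : κ ≤ cs.κ)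
    (hκ₀ : kappa₀ (4 * 2 ^ 4) (2 * 4) ≤ κw / 2) (hκw : κw ≤ κ) (hδ₀ : 0 < δ₀) (hB₃ : 0 ≤ B₃) (hr : 0 < r)
    (h226TOnOlder : ∀ K : ℕ,
      ∀ (D : Set ℂ), IsOpen D → (∀ t ∈ Ioc (0 : ℝ) θ.γ, closedBall (t : ℂ) rE ⊆ D) →
        ∀ (k : ℕ) (g : ℕ → ℝ), g ∈ Window θ.γ → ∀ (i : ℕ), i < k → ∀ (X : (domSys (F.P K) M (k + 1)).Dom) (φ : CPair (F.P K) 𝔸),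
        φ ∈ spaceI (Sg K) (Rz K) M (k + 1) (domSites (F.P K) M (k + 1) X) cs.α₀ cs.α₁ →
        (∀ (j : ℕ), j < k + 1 → ∀ (Y : (domSys (F.P K) M j).Dom) (ψ : CPair (F.P K) 𝔸), ψ ∈ spaceI (Sg K) (Rz K) M j (domSites (F.P K) M j Y) cs.α₀ cs.α₁ →
          ∃ Ec : ℂ → ℂ, DifferentiableOn ℂ Ec D ∧ (∀ z ∈ D, ‖Ec z‖ ≤ E₀ * Real.exp (-(κ * torusTreeLen Y.1))) ∧ (∀ t ∈ Ioc (0 : ℝ) θ.γ, Ec t = termC (S K) j Y (Function.update g i t) ψ)) →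
        ∃ (Hc : ℂ → TDom 4 (domCount (F.P K) M (k + 1)) → ℂ)
          (Tt : (Z : TDom 4 (domCount (F.P K) M (k + 1))) → Finset (TDom 4 (L * domCount (F.P K) M (k + 1))) × Finset (TBond 4 M (L * domCount (F.P K) M (k + 1))) → ℂ → ℂ),
          (∀ Z : (domSys (F.P K) M (k + 1)).Dom, Z.1 ⊆ X.1 → DifferentiableOn ℂ (fun z => Hc z Z) D) ∧
          (∀ z ∈ D, ∀ Z : TDom 4 (domCount (F.P K) M (k + 1)), Z.1 ⊆ X.1 → ‖Hc z Z‖ ≤ ∑ t ∈ terms L M Z, ‖Tt Z t z‖) ∧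
          (∀ z ∈ D, ∀ Z : TDom 4 (domCount (F.P K) M (k + 1)), Z.1 ⊆ X.1 → ∀ t ∈ terms L M Z, ‖Tt Z t z‖ ≤ weight L M c Z a t * Real.exp (a₅ * ((Z.1).card : ℝ))) ∧
          (∀ t ∈ Ioc (0 : ℝ) θ.γ, Hc t = ((S K) k).H (restrictPrefix k (Function.update g i t)) φ))
    (hE : ∀ (K : ℕ), ∀ g ∈ Window θ.γ, ∀ k : ℕ, ∃ H : EHoloAt (sfTowerOfRecord (Sg K) (Rz K) M (S K) ⟨g, β K⟩ (logZ K)) cs k, H.E₀ ≤ E₀ ∧ rE ≤ H.r)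
    (Ec : ℕ → ℕ → Type*) [∀ K k, NormedAddCommGroup (Ec K k)] [∀ K k, NormedSpace ℂ (Ec K k)]
    (ι : letI := θ.instVβ₁; letI := θ.instVβ₂
      (K k : ℕ) → (domSys (F.P K) M (k + 1)).Dom → ((Fin (F.P K).d → Site (F.P K) (k + 1) → θ.Vβ) →L[ℝ] Ec K k))
    (Φ : (K k : ℕ) → (domSys (F.P K) M (k + 1)).Dom → Ec K k → CPair (F.P K) 𝔸)
    (U : (K k : ℕ) → (domSys (F.P K) M (k + 1)).Dom → Set (Ec K k)) (hU : ∀ K k X, IsOpen (U K k X)) (hrU : ∀ K k X, ball (0 : Ec K k) r ⊆ U K k X)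
    (hEhol : ∀ g ∈ Window θ.γ, ∀ (K k : ℕ) (X : (domSys (F.P K) M (k + 1)).Dom), DifferentiableOn ℂ (fun z => ((S K) k).E (histPrefix g k) (Φ K k X z) X) (U K k X))
    (hΦemb : letI := θ.instVβ₁; letI := θ.instVβ₂
      ∀ (K k : ℕ) (X : (domSys (F.P K) M (k + 1)).Dom) (Bp : Fin (F.P K).d → Site (F.P K) (k + 1) → θ.Vβ),
        Φ K k X (ι K k X Bp) = emb K k (fun l t => NormedSpace.exp (θ.ρ8 (Bp l t))))
    (hΦsp : ∀ (K k : ℕ) (X : (domSys (F.P K) M (k + 1)).Dom), ∀ z ∈ ball (0 : Ec K k) r, Φ K k X z ∈ spaceI (Sg K) (Rz K) M (k + 1) (domSites (F.P K) M (k + 1) X) cs.α₀ cs.α₁)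
    (w : (K k : ℕ) → (domSys (F.P K) M (k + 1)).Dom → Site (F.P K) (k + 1) → ℝ) (hw₀ : ∀ K k X t, 0 ≤ w K k X t)
    (hw : letI := θ.instVβ₁; letI := θ.instVβ₂; letI := θ.instιβ
      ∀ (K k : ℕ) (X : (domSys (F.P K) M (k + 1)).Dom) (l : Fin (F.P K).d) (t : Site (F.P K) (k + 1)) (c : θ.ιβ),
        ‖ι K k X (Pi.single l (Pi.single t (θ.bV c)))‖ ≤ w K k X t)
    (htail : ∀ (K k : ℕ) (X : (domSys (F.P K) M (k + 1)).Dom) (t : Site (F.P K) (k + 1)),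
      let e : Site (F.P K) (k + 1) → TPt 4 (domCount (F.P K) M (k + 1) * M) := fun x i => (ZMod.cast (x i) : ZMod (domCount (F.P K) M (k + 1) * M))
      w K k X t ≤ B₃ * Real.exp (-δ₀ * distCT (domCount (F.P K) M (k + 1)) M (e t) (nearT (M := M) (e t) X)))
    (hκ' : κ' ≤ delta1 δ₀ κw ((M : ℝ) * 4)) (μ ν : Fin 4) :
    KernelDecayOfRecord₁₃ F N θ μ ν κ' := by
  letI := θ.instVβ₁; letI := θ.instVβ₂; letI := θ.instιβ
  exact kernelDecayOfRecord₁₃_of_windowedValueLetter F N θ hlim S emb hloc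
    (windowedDecay_localizedSum_of_stripSchemas F m' M hM S emb θ.ρ8 θ.bV Sg Rz logZ β c hL hLc hN cs (Window θ.γ) subset_rfl hγ hrE hA0 hr₁ hκ hrate
      hsmall hrenew hκc hκ₀ hκw hδ₀ hB₃ hr h226TOnOlder hE Ec ι Φ U hU hrU hEhol hΦemb hΦsp w hw₀ hw htail μ ν)
    hκ'

open Classical in
/-- ★★★ **THE (D4) PIN FACE FROM THE PER-STEP SCHEMAS** (J35 v1.1 at the record), every run length `k`, under `hpin`, for a letter block with `ℓ.Signs`, `0 < ℓ.κ ≤ δ₁(δ₀, κ_w)`,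
`β′₅.₁₀(4,1,ℓ.κ) ≤ ℓ.cr`: `kernelDecayOfRecord₁₃_of_stripSchemas` at `(μ, ν) = (0, 1)`, `κ′ := ℓ.κ` ∘ dag-n27-w1's `readOutAt_objectsOfRecord₁₃_coPH` — «W1-20's law + N10's older-coupling
schema + N09's `EHoloAt` families + term holomorphy through the readings + p. 282 tails + (1.21) existence + numerals ⇒ the (D4) pin face at the pinned bundle, every run length».
LOCATED (hypothesis form); (D4) NOT discharged. -/
theorem readOutAt_rateCarriers_of_kernels_pin_of_stripSchemas (𝔯 : RateReading₁₃CoPH N) (θ : Stage13HParams F N) (hP : θ.Provisos₁₃CoPH F N)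
    (g₀ : ℕ → ℝ) (os : List (ULoop F)) (ℓ : U3Letters₁₁) (hs : ℓ.Signs) (hℓ₀ : 0 < ℓ.κ) (hcr : betaPrime510 4 1 ℓ.κ ≤ ℓ.cr)
    (hpin : (𝔯.lit F θ hP g₀ os).u3 = objectsOfRecord₁₃ F N θ.toStage13Params ℓ)
    (hlim : PolLimitsExistOfRecord₁₃ F N θ.toStage13Params)
    {𝔸 : Type*} [NormedRing 𝔸] [NormedAlgebra ℂ 𝔸] [CompleteSpace 𝔸] {G : Type*} [GaugeGroup G] (m' : ℕ) (M : ℕ) [NeZero M] (hM : M = F.L ^ m')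
    (S : (K : ℕ) → ClusterTower (F.P K) 𝔸 M) (emb : ReadingMaps F (MatA N) 𝔸) (hloc : Localizes17OfRecord₁₃ F N θ.toStage13Params S emb)
    (Sg : (K : ℕ) → Setting 𝔸 G) (Rz : (K : ℕ) → Residual (F.P K) 𝔸) (logZ : (K : ℕ) → ℕ → GaugeField (F.P K) 0 G → ℝ) (β : ℕ → ℕ → ℝ → ℝ)
    (c : B13.Consts) {L : ℕ} [NeZero L] (hL : 8 ≤ c.L) (hLc : c.L = L) {a a₂ a₂' a₅ Aabs : ℝ} (hN : Lemma3Numerics c M ((c.L : ℝ) / 2) a a₂ a₂' a₅ Aabs) (cs : SFConsts) (hγ : θ.γ ≤ cs.γ)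
    {rE E₀ κ r₁ κw δ₀ B₃ r : ℝ} (hrE : 0 < rE) (hA0 : 0 ≤ c.C3act * c.ε₁) (hr₁ : 0 ≤ r₁) (hκ : κ ≤ r₁)
    (hrate : r₁ + 2 * (64 * Real.log 162) + 2 ≤ (1 - 8 * c.δ) * ((c.L : ℝ) / 2) * c.κ)
    (hsmall : c.C3act * c.ε₁ * Real.exp (5 * r₁ + 1) * K₀ 64 8 * 9 * 64 ≤ 1)
    (hrenew : Real.exp 1 * 9 * 64 * K₀ 64 8 ^ 2 * (c.C3act * c.ε₁) ≤ E₀) (hκc : κ ≤ cs.κ)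
    (hκ₀ : kappa₀ (4 * 2 ^ 4) (2 * 4) ≤ κw / 2) (hκw : κw ≤ κ) (hδ₀ : 0 < δ₀) (hB₃ : 0 ≤ B₃) (hr : 0 < r)
    (h226TOnOlder : ∀ K : ℕ,
      ∀ (D : Set ℂ), IsOpen D → (∀ t ∈ Ioc (0 : ℝ) θ.γ, closedBall (t : ℂ) rE ⊆ D) →
        ∀ (k : ℕ) (g : ℕ → ℝ), g ∈ Window θ.γ → ∀ (i : ℕ), i < k → ∀ (X : (domSys (F.P K) M (k + 1)).Dom) (φ : CPair (F.P K) 𝔸),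
        φ ∈ spaceI (Sg K) (Rz K) M (k + 1) (domSites (F.P K) M (k + 1) X) cs.α₀ cs.α₁ →
        (∀ (j : ℕ), j < k + 1 → ∀ (Y : (domSys (F.P K) M j).Dom) (ψ : CPair (F.P K) 𝔸), ψ ∈ spaceI (Sg K) (Rz K) M j (domSites (F.P K) M j Y) cs.α₀ cs.α₁ →
          ∃ Ec : ℂ → ℂ, DifferentiableOn ℂ Ec D ∧ (∀ z ∈ D, ‖Ec z‖ ≤ E₀ * Real.exp (-(κ * torusTreeLen Y.1))) ∧ (∀ t ∈ Ioc (0 : ℝ) θ.γ, Ec t = termC (S K) j Y (Function.update g i t) ψ)) →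
        ∃ (Hc : ℂ → TDom 4 (domCount (F.P K) M (k + 1)) → ℂ)
          (Tt : (Z : TDom 4 (domCount (F.P K) M (k + 1))) → Finset (TDom 4 (L * domCount (F.P K) M (k + 1))) × Finset (TBond 4 M (L * domCount (F.P K) M (k + 1))) → ℂ → ℂ),
          (∀ Z : (domSys (F.P K) M (k + 1)).Dom, Z.1 ⊆ X.1 → DifferentiableOn ℂ (fun z => Hc z Z) D) ∧
          (∀ z ∈ D, ∀ Z : TDom 4 (domCount (F.P K) M (k + 1)), Z.1 ⊆ X.1 → ‖Hc z Z‖ ≤ ∑ t ∈ terms L M Z, ‖Tt Z t z‖) ∧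
          (∀ z ∈ D, ∀ Z : TDom 4 (domCount (F.P K) M (k + 1)), Z.1 ⊆ X.1 → ∀ t ∈ terms L M Z, ‖Tt Z t z‖ ≤ weight L M c Z a t * Real.exp (a₅ * ((Z.1).card : ℝ))) ∧
          (∀ t ∈ Ioc (0 : ℝ) θ.γ, Hc t = ((S K) k).H (restrictPrefix k (Function.update g i t)) φ))
    (hE : ∀ (K : ℕ), ∀ g ∈ Window θ.γ, ∀ k : ℕ, ∃ H : EHoloAt (sfTowerOfRecord (Sg K) (Rz K) M (S K) ⟨g, β K⟩ (logZ K)) cs k, H.E₀ ≤ E₀ ∧ rE ≤ H.r)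
    (Ec : ℕ → ℕ → Type*) [∀ K k, NormedAddCommGroup (Ec K k)] [∀ K k, NormedSpace ℂ (Ec K k)]
    (ι : letI := θ.instVβ₁; letI := θ.instVβ₂
      (K k : ℕ) → (domSys (F.P K) M (k + 1)).Dom → ((Fin (F.P K).d → Site (F.P K) (k + 1) → θ.Vβ) →L[ℝ] Ec K k))
    (Φ : (K k : ℕ) → (domSys (F.P K) M (k + 1)).Dom → Ec K k → CPair (F.P K) 𝔸)
    (U : (K k : ℕ) → (domSys (F.P K) M (k + 1)).Dom → Set (Ec K k)) (hU : ∀ K k X, IsOpen (U K k X)) (hrU : ∀ K k X, ball (0 : Ec K k) r ⊆ U K k X)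
    (hEhol : ∀ g ∈ Window θ.γ, ∀ (K k : ℕ) (X : (domSys (F.P K) M (k + 1)).Dom), DifferentiableOn ℂ (fun z => ((S K) k).E (histPrefix g k) (Φ K k X z) X) (U K k X))
    (hΦemb : letI := θ.instVβ₁; letI := θ.instVβ₂
      ∀ (K k : ℕ) (X : (domSys (F.P K) M (k + 1)).Dom) (Bp : Fin (F.P K).d → Site (F.P K) (k + 1) → θ.Vβ),
        Φ K k X (ι K k X Bp) = emb K k (fun l t => NormedSpace.exp (θ.ρ8 (Bp l t))))
    (hΦsp : ∀ (K k : ℕ) (X : (domSys (F.P K) M (k + 1)).Dom), ∀ z ∈ ball (0 : Ec K k) r, Φ K k X z ∈ spaceI (Sg K) (Rz K) M (k + 1) (domSites (F.P K) M (k + 1) X) cs.α₀ cs.α₁)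
    (w : (K k : ℕ) → (domSys (F.P K) M (k + 1)).Dom → Site (F.P K) (k + 1) → ℝ) (hw₀ : ∀ K k X t, 0 ≤ w K k X t)
    (hw : letI := θ.instVβ₁; letI := θ.instVβ₂; letI := θ.instιβ
      ∀ (K k : ℕ) (X : (domSys (F.P K) M (k + 1)).Dom) (l : Fin (F.P K).d) (t : Site (F.P K) (k + 1)) (c : θ.ιβ),
        ‖ι K k X (Pi.single l (Pi.single t (θ.bV c)))‖ ≤ w K k X t)
    (htail : ∀ (K k : ℕ) (X : (domSys (F.P K) M (k + 1)).Dom) (t : Site (F.P K) (k + 1)),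
      let e : Site (F.P K) (k + 1) → TPt 4 (domCount (F.P K) M (k + 1) * M) := fun x i => (ZMod.cast (x i) : ZMod (domCount (F.P K) M (k + 1) * M))
      w K k X t ≤ B₃ * Real.exp (-δ₀ * distCT (domCount (F.P K) M (k + 1)) M (e t) (nearT (M := M) (e t) X)))
    (hℓκ : ℓ.κ ≤ delta1 δ₀ κw ((M : ℝ) * 4)) (k : ℕ) :
    ReadOutAt (datumOfRecord₁₃CoPH F N θ hP) (rateCarriersOfRecord₁₃CoPH 𝔯 F θ hP g₀ os k).u3 := by
  show ReadOutAt (datumOfRecord₁₃CoPH F N θ hP) (u3OfRecord₁₃ θ.toStage13Params (𝔯.lit F θ hP g₀ os).u3 k)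
  rw [hpin]
  exact readOutAt_objectsOfRecord₁₃_coPH θ hP ℓ hs hℓ₀ hcr k
    (kernelDecayOfRecord₁₃_of_stripSchemas F N θ.toStage13Params hlim m' M hM S emb hloc Sg Rz logZ β c hL hLc hN cs hγ hrE hA0 hr₁ hκ hrate hsmall hrenew
      hκc hκ₀ hκw hδ₀ hB₃ hr h226TOnOlder hE Ec ι Φ U hU hrU hEhol hΦemb hΦsp w hw₀ hw htail hℓκ 0 1)

end YMDAG.N22.AtRecordOfPrintedSlots

end
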